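import Literature.IUT.LogVolume.HaarTransport
import Literature.IUT.LogThetaLattice.PacketLogVolumes
import HarnessLib

/-!
# [IUTchIII] Proposition 3.9 (ii) "(Mono-analytic Compatibility)" at real Haar log-volumes

Mochizuki, *Inter-universal Teichmüller theory III*, Prop. 3.9 (ii), kurims p. 116: the mono-analytic
log-volume on `𝓘^ℚ(^α𝒟^⊢_{v_ℚ})` is "compatible with the log-volumes obtained in (i), relative to the natural
poly-isomorphisms of Proposition 3.2, (i)". The layer-L6 statement file `PacketLogVolumes.lean`
(abc-iut-L6-t4) types this as the SLOT
`Prop39ii_monoAnalyticCompat poly μD μF := ∀ e ∈ poly, ∀ S, μD S = μF (e '' S)` over abstract carriers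
`XD ≃ XF`, an abstract poly-isomorphism and abstract log-volumes.

This proof-only file DISCHARGES the slot for REAL log-volumes: whenever the two carriers are topological
abelian groups with integral structures `Λ ⊆ V`, `Λ' ⊆ W` (`Literature.IUT.LogVolume.IntegralStructure`),
the log-volumes are the normalised Haar log-volumes `μ^log_Λ`, `μ^log_{Λ'}` (or their weight-`d`
normalisations), and every member of the poly-isomorphism is (the underlying bijection of) a bicontinuous
additive isomorphism carrying `Λ` onto `Λ'` — as the isomorphisms of log-shells induced by isomorphisms of
`𝒟^⊢`- or `𝓕^{⊢×μ}`-prime-strips are — then `Prop39ii_monoAnalyticCompat poly μ^log_Λ μ^log_{Λ'}` HOLDS, by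
Haar transport (`IntegralStructure.logVolume_image_equiv` of `HaarTransport.lean`). For one nonarchimedean
local field on each side the hypothesis is just "norm-preserving" (`…_of_norm_map_eq`, the unit balls are
the integral structures). Written by the wave-3 discharge seat abc-iut-c312-d1 (cell abc-iut).
[cite: Mochizuki2012, IUTchIII Prop. 3.9 (ii) p. 116] Deliberately NOT here: the construction of the
poly-isomorphism of Prop. 3.2 (i) from prime-strips (layers L4/L6), the procession-normalised and
"`𝓕^{⊢×μ}`" variants (same proof once their carriers are instantiated), any judgement on Cor. 3.12.
-/

noncomputable section

open MeasureTheory Set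

namespace Literature.IUT.LogVolume

universe u

section Transport

variable {V W : Type u} [AddCommGroup V] [TopologicalSpace V] [IsTopologicalAddGroup V]
  [MeasurableSpace V] [BorelSpace V] [AddCommGroup W] [TopologicalSpace W] [IsTopologicalAddGroup W]
  [MeasurableSpace W] [BorelSpace W] (Λ : IntegralStructure V) (Λ' : IntegralStructure W)

/-- **Prop. 3.9 (ii) for real Haar log-volumes.** If every member `e` of the poly-isomorphism is the
underlying bijection of a bicontinuous additive isomorphism `φ : V ≃ W` with `φ(Λ) = Λ'`, then the
log-volumes `μ^log_Λ`, `μ^log_{Λ'}` are compatible relative to the poly-isomorphism: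
`μ^log_Λ(S) = μ^log_{Λ'}(e(S))` for all `e`, `S`. [cite: Mochizuki2012, IUTchIII Prop. 3.9 (ii) p. 116] -/
theorem prop39ii_monoAnalyticCompat_logVolume (poly : Set (V ≃ W))
    (hpoly : ∀ e ∈ poly, ∃ φ : V ≃ₜ+ W, (∀ x, φ x = e x) ∧ φ '' (Λ : Set V) = (Λ' : Set W)) :
    LogThetaLattice.Prop39ii_monoAnalyticCompat poly Λ.logVolume Λ'.logVolume := by
  intro e he S
  obtain ⟨φ, hφe, hφ⟩ := hpoly e he
  have himage : (e : V → W) '' S = φ '' S := Set.image_congr fun x _ => (hφe x).symm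
  rw [himage, Λ.logVolume_image_equiv Λ' φ hφ]

/-- The same for the weight-`d` normalised log-volumes (the "procession-normalized"/degree-normalised
versions carry the same weight on both sides of an isomorphism).
[cite: Mochizuki2012, IUTchIII Prop. 3.9 (ii) p. 116] -/
theorem prop39ii_monoAnalyticCompat_normalizedLogVolume (d : ℕ) (poly : Set (V ≃ W))
    (hpoly : ∀ e ∈ poly, ∃ φ : V ≃ₜ+ W, (∀ x, φ x = e x) ∧ φ '' (Λ : Set V) = (Λ' : Set W)) :
    LogThetaLattice.Prop39ii_monoAnalyticCompat poly (Λ.normalizedLogVolume d)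
      (Λ'.normalizedLogVolume d) := by
  intro e he S
  obtain ⟨φ, hφe, hφ⟩ := hpoly e he
  have himage : (e : V → W) '' S = φ '' S := Set.image_congr fun x _ => (hφe x).symm
  rw [himage, Λ.normalizedLogVolume_image_equiv Λ' d φ hφ]

end Transport

section LocalField

variable {K K' : Type u} [NontriviallyNormedField K] [IsUltrametricDist K] [ProperSpace K]
  [MeasurableSpace K] [BorelSpace K] [NontriviallyNormedField K'] [IsUltrametricDist K']
  [ProperSpace K'] [MeasurableSpace K'] [BorelSpace K']

/-- **Prop. 3.9 (ii) between two local fields**: if every member of the poly-isomorphism is the underlying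
bijection of a norm-preserving additive homeomorphism `k ≃ k'` (e.g. an isomorphism of topological
fields), the log-volumes `μ^log_k`, `μ^log_{k'}` are compatible relative to it.
[cite: Mochizuki2012, IUTchIII Prop. 3.9 (ii) p. 116] -/
theorem prop39ii_monoAnalyticCompat_localLogVolume (poly : Set (K ≃ K'))
    (hpoly : ∀ e ∈ poly, ∃ φ : K ≃ₜ+ K', (∀ x, φ x = e x) ∧ ∀ x, ‖φ x‖ = ‖x‖) :
    LogThetaLattice.Prop39ii_monoAnalyticCompat poly (localLogVolume K) (localLogVolume K') := by
  intro e he S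
  obtain ⟨φ, hφe, hφ⟩ := hpoly e he
  have himage : (e : K → K') '' S = φ '' S := Set.image_congr fun x _ => (hφe x).symm
  rw [himage, localLogVolume_image_equiv_of_norm_map_eq K K' φ hφ]

/-- The same for the degree-normalised local log-volumes (same weight `d = [k:ℚ_p] = [k':ℚ_p]`).
[cite: Mochizuki2012, IUTchIII Prop. 3.9 (ii) p. 116] -/
theorem prop39ii_monoAnalyticCompat_normalizedLocalLogVolume (d : ℕ) (poly : Set (K ≃ K'))
    (hpoly : ∀ e ∈ poly, ∃ φ : K ≃ₜ+ K', (∀ x, φ x = e x) ∧ ∀ x, ‖φ x‖ = ‖x‖) :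
    LogThetaLattice.Prop39ii_monoAnalyticCompat poly (normalizedLocalLogVolume K d)
      (normalizedLocalLogVolume K' d) := by
  intro e he S
  obtain ⟨φ, hφe, hφ⟩ := hpoly e he
  have himage : (e : K → K') '' S = φ '' S := Set.image_congr fun x _ => (hφe x).symm
  rw [himage, normalizedLocalLogVolume_image_equiv_of_norm_map_eq K K' d φ hφ]

end LocalField

end Literature.IUT.LogVolume

end
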